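import Summits.ResolutionOfSingularities.ResolutionOfSingularities.Theses.Dominance
import Summits.ResolutionOfSingularities.ResolutionOfSingularities.Theses.PAlteration
import Summits.ResolutionOfSingularities.ResolutionOfSingularities.Theses.Valuative
import Summits.ResolutionOfSingularities.ResolutionOfSingularities.Theorems.PAlterationPicoverLocalModelCases
import Summits.ResolutionOfSingularities.ResolutionOfSingularities.Theorems.PAlterationPicoverLocalModelToLuAlphaPTorsor
import Summits.ResolutionOfSingularities.ResolutionOfSingularities.Theorems.RadicandSplitCorank
import HarnessLib

/-!
# PicoverLocalModelCorankLadder — kernels of the decomp-res node «CorankLadder» (lens-1 g7) BY NAME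

Source HOME/decomp-res-lens-1/g7/CorankLadder.lean (sha256 6d558789858ead62; critic `lean check` rc 0, 0 sorry,
`root_of` axioms standard), CRITIC-LEDGER row 48 (2026-08-30T07:33Z): CLEARED AS MAP NODE, child of the portfolio
blocker `PAlteration.PicoverLocalModel` (item stmt-ResolutionOfSingularities-0557, route `pAlteration`; residual 0 ·
decision 0 · map +1).  ONE integer, dimension-free: the SPLIT CORANK `c` of the radicand class (vocabulary and
parametrised pieces landed in `Theorems.RadicandSplitCorank`, p765336).  Pieces = asides of `Theses/Dominance.lean`
(hosted there by the cell's writer; 0557's own route belongs to another planner — re-informal of 0557 owed):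
`PicoverCorankLEThree` 30325 [NECESSARY; WEAKER by letter (every catalogued pathology has q = 0, i.e. grade c = n,
outside LE 3 for n ≥ 4); UNDECIDED ≡ `WeakMarkedRadicandThree` mod ports P1/P2/P4 = the cell's convergence cell
reached from the BLOCKER side for all n; IDEA-NEEDED; barrier `DimensionFourFrontier` conceded],
`PicoverCorankGTThree` 30326 [DECLARED RESIDUAL, cofinal, score 0, NOT weaker], `PicoverCorankLETwo` 30327
[KNOWN-MOD-PORT(L): non-critical points regular, Kummer points log regular (Kato), tail c ≤ 2 by CJS 2020 Thm. 1.4;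
ports P1 M, P3 M, P4 = the one real L-port; isolated-critical slice DECIDED-MOD-PORT(M) via row 43],
`WeakMarkedRadicandThree` 30328 [typed ATTACK LEAF, not S-implied by letter, INSTRUMENTABLE]. Kernels (all PROVED, 0
sorry): `picoverLocalModel_iff` (EXACT, every c: 0557 ⟺ CorankLE c ∧ CorankGT c, by excluded middle on the pointwise
class hypothesis), `closes` (the two Three-asides ⟹ 0557 BY NAME), `corankLETwo_of_three`, `root_of` (ROOT via
`Valuative.closes` with `TorsorToLurel` 10968 and `PatchingRel` 0642 BY NAME and the tree's
`luAlphaPTorsor_of_picoverLocalModel`), necessity `picoverLocalModel_of_root`, `pieces_of_root`,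
`pieces_of_picoverLocalModel`, `asides_of_root`. Why this is novel (cell-relative): the first typed, exact,
ALL-DIMENSION ladder on the blocker 0557 whose order parameter is the split corank (known range c ≤ 2 for every n
and p; first open rung c = 3 pinned to ONE 4-dimensional embedded statement); the tree's 0557 line grades by
dimension n instead.  [CossartJannsenSaito2020 Thm. 1.4; Kato1994; CossartPiltant2019; Temkin2013]
-/

namespace Summit.ResolutionOfSingularities.ResolutionOfSingularities.Theorems.PicoverLocalModelCorankLadder

open AlgebraicGeometry Literature.AlgebraicGeometry.Resolution
open Summit.ResolutionOfSingularities.ResolutionOfSingularities.Theses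
open Summit.ResolutionOfSingularities.ResolutionOfSingularities.Theorems
open RadicandSplitCorank

/-! ## EXACT decomposition of the blocker 0557 BY NAME -/

/-- EXACTNESS at every grade: the blocker is the conjunction of its grade-`c` piece and its grade-`> c` residual
(excluded middle on the pointwise class hypothesis; `LocalModelRes` is 0557's conclusion verbatim). [folklore] -/
theorem picoverLocalModel_iff (c : ℕ) :
    PAlteration.PicoverLocalModel ↔ PicoverLocalModelCorankLE c ∧ PicoverLocalModelCorankGT c := by
  constructor
  · intro h
    exact ⟨fun p hp k _ _ R _ _ _ hft hreg a _ => h p hp k R hft hreg a,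
      fun p hp k _ _ R _ _ _ hft hreg a _ => h p hp k R hft hreg a⟩
  · rintro ⟨hle, hgt⟩ p hp k _ _ R _ _ _ hft hreg a
    by_cases hgood : AllGoodLE p c R a
    · exact hle p hp k R hft hreg a hgood
    · exact hgt p hp k R hft hreg a hgood

/-- The Dominance asides ARE the grade-3 pieces (definitional). [folklore] -/
theorem corankLEThree_iff : Dominance.PicoverCorankLEThree ↔ PicoverLocalModelCorankLE 3 := Iff.rfl

/-- (definitional) [folklore] -/
theorem corankGTThree_iff : Dominance.PicoverCorankGTThree ↔ PicoverLocalModelCorankGT 3 := Iff.rfl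

/-- (definitional) [folklore] -/
theorem corankLETwo_iff : Dominance.PicoverCorankLETwo ↔ PicoverLocalModelCorankLE 2 := Iff.rfl

/-- (definitional) [folklore] -/
theorem weakMarkedRadicandThree_iff : Dominance.WeakMarkedRadicandThree ↔ WeakMarkedRadicand 3 := Iff.rfl

/-- **`closes` — the node decides the BLOCKER BY NAME**: grade `≤ 3` and the residual give
`PAlteration.PicoverLocalModel` (stmt-0557). [folklore] -/
theorem closes (h₃ : Dominance.PicoverCorankLEThree) (h₄ : Dominance.PicoverCorankGTThree) :
    PAlteration.PicoverLocalModel :=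
  (picoverLocalModel_iff 3).mpr ⟨h₃, h₄⟩

/-- **EXACT at grade 3 BY NAME: 0557 ⟺ PicoverCorankLEThree ∧ PicoverCorankGTThree.** [folklore] -/
theorem picoverLocalModel_iff_asides :
    PAlteration.PicoverLocalModel ↔ Dominance.PicoverCorankLEThree ∧ Dominance.PicoverCorankGTThree :=
  picoverLocalModel_iff 3

/-- The known grade rides along: the `≤ 2` aside is a special case of the `≤ 3` aside. [folklore] -/
theorem corankLETwo_of_three (h₃ : Dominance.PicoverCorankLEThree) : Dominance.PicoverCorankLETwo :=
  corankLE_mono (by norm_num) h₃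

/-! ## Up to ROOT BY NAME (through the `Valuative` route's deciding theorem) -/

/-- ROOT-level deciding theorem: the two grade-3 asides, Temkin's inseparable reduction (`Valuative.TorsorToLurel`,
item 10968) and Zariski patching (`Valuative.PatchingRel`, item 0642) give the summit — through the tree's
`luAlphaPTorsor_of_picoverLocalModel` and `Valuative.closes`; every binder is an aside of this node or a live item BY
NAME. [folklore] -/
theorem root_of (h₃ : Dominance.PicoverCorankLEThree) (h₄ : Dominance.PicoverCorankGTThree)
    (hT : Valuative.TorsorToLurel) (hP : Valuative.PatchingRel) : _root_.ResolutionOfSingularities :=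
  Valuative.closes (luAlphaPTorsor_of_picoverLocalModel (closes h₃ h₄)) hT hP

/-! ## Down: necessity (nothing here is stronger than the summit) -/

/-- The summit implies the blocker (tree: `picoverLocalModel_of_resolutionInChar`). [folklore] -/
theorem picoverLocalModel_of_root (h : _root_.ResolutionOfSingularities) : PAlteration.PicoverLocalModel :=
  fun p hp k _ _ R _ _ _ hft hreg a => picoverLocalModel_of_resolutionInChar p hp (h p hp) k R hft hreg a

/-- NECESSITY: the summit implies every piece at every grade. [folklore] -/
theorem pieces_of_root (h : _root_.ResolutionOfSingularities) (c : ℕ) :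
    PicoverLocalModelCorankLE c ∧ PicoverLocalModelCorankGT c :=
  (picoverLocalModel_iff c).mp (picoverLocalModel_of_root h)

/-- The blocker itself implies every piece (restriction). [folklore] -/
theorem pieces_of_picoverLocalModel (h : PAlteration.PicoverLocalModel) (c : ℕ) :
    PicoverLocalModelCorankLE c ∧ PicoverLocalModelCorankGT c :=
  (picoverLocalModel_iff c).mp h

/-- NECESSITY BY NAME: the summit implies the three `Picover…` asides of this node. [folklore] -/
theorem asides_of_root (h : _root_.ResolutionOfSingularities) :
    Dominance.PicoverCorankLEThree ∧ Dominance.PicoverCorankGTThree ∧ Dominance.PicoverCorankLETwo :=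
  have h3 := pieces_of_root h 3
  ⟨h3.1, h3.2, corankLETwo_of_three h3.1⟩

/-- The blocker 0557 implies the three `Picover…` asides (so each is AT MOST the blocker by letter). [folklore] -/
theorem asides_of_picoverLocalModel (h : PAlteration.PicoverLocalModel) :
    Dominance.PicoverCorankLEThree ∧ Dominance.PicoverCorankGTThree ∧ Dominance.PicoverCorankLETwo :=
  have h3 := pieces_of_picoverLocalModel h 3
  ⟨h3.1, h3.2, corankLETwo_of_three h3.1⟩

end Summit.ResolutionOfSingularities.ResolutionOfSingularities.Theorems.PicoverLocalModelCorankLadder
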